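/-
Origin: expansion seat `prover-pub-hodgecm-mc-carch-1-g35-0`, handover #CA62 2026-08-20T23:20Z md5 b774229d86f4 (537 l.; NEW additive leaf; imports Model.ArchKTypeOfSlotChar; ns HodgeCM.Model(.ArchPair); 16 theorems; NAMES for audit: HodgeCM.Model.hd_lineOmega_zeroG · HodgeCM.Model.hCR_lineOmega_zeroG · HodgeCM.Model.ArchPair.differentiableAt_of_blockPair) (`HOME/mc/pub-hodgecm-mc-carch-1/stage66/HodgeCM/Model/ArchKTypeOfDistHol.lean`, md5 b774229d86f4, 537 lines);
landed by the second packager p2 gen 15 (p2-g15) in gate run 66 as `HodgeCM/Model/ArchKTypeOfDistHol.lean` (verbatim).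
-/
/-
Copyright (c) 2026. Released under Apache 2.0 license as described in the file LICENSE.
Cell pub-hodgecm, MODEL layer (construction prover mc-carch-1, gen 35), row-9 (J-Liu-Θ) junction, (J4) distribution input —
rows 14/15 (`hpd`/`hk`) of E IN THE N-FREE CURRENCY: the (AN)/(REP) facts of the honest archimedean pair `(lineOmega_k ∘ expP, Φ_∞,k)`
WITHOUT the `ArchKTypeData` record (sinst-1-g10 REQUEST 2026-08-20T23:10Z (a4)/(a5)).
-/
import Summits.HodgeConjecture.HodgeCM.Model.ArchKTypeOfSlotChar_2

/-!
# (AN) and (REP′) for the honest archimedean factor on the harmonic family, record-free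

E's binders `hpd` (row 14, (AN): weak real-differentiability at `0` of `b ↦ T (ω_∞(e b) Φ_∞(ℓ))`) and `hk` (row 15, (REP): the
`𝔭₋`-limits) are stated in `Model/ThetaHolAssembly` / `Model/ThetaHolDirections` as predicates of an `ArchKTypeData` RECORD, and carch's
rows-14/15 theorems (`isWeaklyPDiff_archKTypeOfSlotZero/OneG`, `isPMinusKilledAlong_…_twistG`, #CA14) live on the record built by
`archKTypeOf`, whose constructor wants the `φ_N`-specific inputs `N Γ₀ hlevel ℓ₀ arch₀ harch hfin`.  The (J4) theta distribution is
test-function-free; what its block clause (#1251 `exists_mem_holSatU_clsU_mem_block_archSideOf_zero/_one`) takes as hypotheses is the UNFOLDED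
pair on `(lineOmega_k, Φarch)`.  This file supplies it:

* § 1 the two junction bricks of theta-3's `Model/ArchKTypeJunction` (`ArchKTypeData.isWeaklyPDiff_of_blockPair`,
  `isPMinusKilledAlong_of_blockPair`) RE-STATED RECORD-FREE for a pair `(ρ : (Fin 2 → ℂ) → End 𝓢(E′, ℂ), Φ : Λ → 𝓢(E′, ℂ))` — same proofs
  (`differentiableAt_charTwist_expP`, `weilDatum_pMinus_expP_map`, `exists_circle_twist_factorisation_clm`), the record entered only through
  `hτ`/`hΦ` (`ArchPair.differentiableAt_of_blockPair`, `ArchPair.pMinus_of_blockPair`);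
* § 2 at the pin's literal slots (`k = 0, 1`; inputs `h₁W`, `eR eS`, `Φ₂` only): (a4-twist) `differentiableAt_lineOmega_zero/one_twistU21_expPG`
  and (REP-twist) `pMinus_lineOmega_zero/one_twistU21_expPG` along `twistU21 ∘ expP` — the instantiation of #CA14
  `isWeaklyPDiff_archKTypeOfSlotZeroG` / `isPMinusKilledAlong_archKTypeOfSlotZero_twistG` verbatim, minus the record;
* § 3 with the canonical representative `hemb : (mk ι₁).embedding = ι₁` (`twistU21 = id`): **(a4) `hd_lineOmega_zero/oneG`**
  `DifferentiableAt ℝ (fun b => T (lineOmega_k … (expP b) (Φ_∞,k(ℓ)))) 0` and **(a5) `hCR_lineOmega_zero/oneG`**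
  `fderiv ℝ (…) 0 (I • v) = I • fderiv ℝ (…) 0 v` — the record-free twin of `ThetaHolDirections.isWeaklyCR_of_isPMinusKilledAlong`
  (`apply_I_smul_of_basis` + `ThetaHolAssembly.fderiv_I_smul_of_slopes`, `c p := -I`) — VERBATIM the hypotheses `hd`/`hCR` of sinst-1's #1251.

Nothing is cited and nothing is minted: kernel lemmas over installed carch/theta-3 modules; 0 records, 0 `def … : Prop`.
-/

set_option autoImplicit false

noncomputable section

open Filter Topology Complex
open NumberField NumberField.InfinitePlace NumberField.mixedEmbedding IsDedekindDomain MeasureTheory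
open scoped Matrix TensorProduct Classical SchwartzMap
open MulAction
open Literature.Geometry.ComplexHyperbolic.BallModel (U21 x₀ stabilizerEquivK21)
open Literature.NumberTheory.Automorphic.U21 (K21 matA sclD pPlus pPlus_apply)
open Literature.AlgebraicGeometry.HodgeTheory
open Literature.AlgebraicGeometry.ShimuraVarieties Literature.AlgebraicGeometry.ShimuraVarieties.BallForms
open Literature.NumberTheory.Automorphic Literature.NumberTheory.Weil1964
open Literature.RepresentationTheory.HeisenbergGroup (polar Heisenberg symplecticGroup ofSymplectic)
open Literature.RepresentationTheory.KonnoKonno2007 Literature.RepresentationTheory.KonnoKonno2007.RealDualPair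
open Literature.NumberTheory.GelbartRogawski1991 Literature.NumberTheory.GelbartRogawski1991.UnitaryDualPair
open Literature.Analysis.SegalBargmann Literature.Analysis.Distribution
open Literature.NumberTheory.Automorphic.PicardCM
open HodgeCM.Adelic HodgeCM.PerL34 HodgeCM.Model.HypCensus HodgeCM.Model.SupplyInstance HodgeCM.Model.ArchSideTerm

namespace HodgeCM.Model

/-! ### § 1. The junction bricks, record-free -/

namespace ArchPair

section Bricks

variable {E' : Type*} [NormedAddCommGroup E'] [NormedSpace ℝ E']
variable {Λ : Type*} (ρ : (Fin 2 → ℂ) → (𝓢(E', ℂ) →ₗ[ℂ] 𝓢(E', ℂ))) (Φ : Λ → 𝓢(E', ℂ))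
variable {R S : Type} [Fintype R] [DecidableEq R] [Fintype S] [DecidableEq S]

set_option backward.isDefEq.respectTransparency false in
/-- **(AN) for a pair intertwined with a twisted junction datum, record-free** (theta-3 `ArchKTypeData.isWeaklyPDiff_of_junction` with
`B.ωinf (e b) ↦ ρ b`, `B.Φarch ↦ Φ`). -/
theorem differentiableAt_of_junction
    {ω₁ : Representation ℂ (Ginf (Fin 2) Unit R S) (SchwartzMap (DPIdx (Fin 2) Unit R S → ℝ) ℂ)}
    (hW₁ : IsArchWeilDatum (ι𝕎 (Fin 2) Unit R S) ω₁) {ev : VacExponents}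
    (hvac₁ : ∀ kk : DPK (Fin 2) Unit R S, ω₁ (κ (Fin 2) Unit R S kk) (hermitePi 0) = vacScalar ev kk • hermitePi 0)
    (χc : Ginf (Fin 2) Unit R S →* Circle) (hχc : Continuous χc)
    (L : SchwartzMap (DPIdx (Fin 2) Unit R S → ℝ) ℂ →L[ℂ] 𝓢(E', ℂ))
    (Φ₁ : Λ → SchwartzMap (DPIdx (Fin 2) Unit R S → ℝ) ℂ)
    (hΦ : ∀ ℓ, Φ ℓ = L (Φ₁ ℓ))
    (hω : ∀ (b : Fin 2 → ℂ) (ℓ : Λ), ρ b (L (Φ₁ ℓ)) =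
      L (charTwist (Circle.coeHom.comp χc) ω₁
        (((u21FrameEquiv (expP b) : UForm (Fin 2) Unit), (1 : UForm R S)) : Ginf (Fin 2) Unit R S) (Φ₁ ℓ)))
    (T : 𝓢(E', ℂ) →L[ℂ] ℂ) (ℓ : Λ) :
    DifferentiableAt ℝ (fun b => T (ρ b (Φ ℓ))) 0 := by
  have hχ : Continuous (Circle.coeHom.comp χc : Ginf (Fin 2) Unit R S →* ℂ) := continuous_subtype_val.comp hχc
  have h := differentiableAt_charTwist_expP (V := ℂ) hW₁ hvac₁ hχ ((T.comp L).restrictScalars ℝ) (Φ₁ ℓ) 0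
  refine h.congr_of_eventuallyEq (Filter.Eventually.of_forall fun b => ?_)
  simp only [hΦ, hω, ContinuousLinearMap.coe_restrictScalars', ContinuousLinearMap.coe_comp,
    Function.comp_apply]

set_option backward.isDefEq.respectTransparency false in
/-- **(REP) along `-i e_p` for a pair intertwined with a twisted junction datum, record-free** (theta-3
`ArchKTypeData.isPMinusKilledAlong_of_junction` with `B.ωinf (e b) ↦ ρ b`, `B.Φarch ↦ Φ`). -/
theorem pMinus_of_junction
    {ω₁ : Representation ℂ (Ginf (Fin 2) Unit R S) (SchwartzMap (DPIdx (Fin 2) Unit R S → ℝ) ℂ)}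
    (hW₁ : IsArchWeilDatum (ι𝕎 (Fin 2) Unit R S) ω₁)
    (χc : Ginf (Fin 2) Unit R S →* Circle) (hχc : Continuous χc)
    (L : SchwartzMap (DPIdx (Fin 2) Unit R S → ℝ) ℂ →L[ℂ] 𝓢(E', ℂ))
    (Φ₁ : Λ → SchwartzMap (DPIdx (Fin 2) Unit R S → ℝ) ℂ)
    (hΦ : ∀ ℓ, Φ ℓ = L (Φ₁ ℓ))
    (hω : ∀ (b : Fin 2 → ℂ) (ℓ : Λ), ρ b (L (Φ₁ ℓ)) =
      L (charTwist (Circle.coeHom.comp χc) ω₁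
        (((u21FrameEquiv (expP b) : UForm (Fin 2) Unit), (1 : UForm R S)) : Ginf (Fin 2) Unit R S) (Φ₁ ℓ)))
    (p : Fin 2)
    (hf : ∀ ℓ, hypOpGen R S p () (Φ₁ ℓ) + I • rotBoostGen R S p () (Real.pi / 2) (Φ₁ ℓ) = 0) (ℓ : Λ) :
    ∃ D Dᵢ : 𝓢(E', ℂ),
      Tendsto (fun t : ℝ => t⁻¹ • (ρ (t • (-Complex.I • (Pi.single p 1 : Fin 2 → ℂ))) (Φ ℓ) - Φ ℓ)) (𝓝[≠] 0) (𝓝 D) ∧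
        Tendsto (fun t : ℝ => t⁻¹ • (ρ (t • (Complex.I • (-Complex.I • (Pi.single p 1 : Fin 2 → ℂ)))) (Φ ℓ) - Φ ℓ))
          (𝓝[≠] 0) (𝓝 Dᵢ) ∧ D + Complex.I • Dᵢ = 0 := by
  obtain ⟨D, Dᵢ, h₁, h₂, h₃⟩ := weilDatum_pMinus_expP_map (hW₁.twist χc hχc) p (Φ₁ ℓ) (hf ℓ) L
  refine ⟨D, Dᵢ, ?_, ?_, h₃⟩
  · simpa only [hΦ, hω] using h₁
  · simpa only [hΦ, hω] using h₂

set_option backward.isDefEq.respectTransparency false in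
/-- **(AN) from the big archimedean datum, record-free** (theta-3 `ArchKTypeData.isWeaklyPDiff_of_blockPair` with `B.ωinf (e b) ↦ ρ b`,
`B.Φarch ↦ Φ`): `b ↦ T (ρ b (Φ ℓ))` is real-differentiable at `0`. -/
theorem differentiableAt_of_blockPair {σ₂ : Type} [Fintype σ₂] [DecidableEq σ₂]
    {G : Type} [Group G] [TopologicalSpace G]
    {ι𝕎' : G →* symplecticGroup (polar (dotPairing (DPIdx (Fin 2) Unit R S ⊕ σ₂)))}
    {ω : Representation ℂ G (SchwartzMap (DPIdx (Fin 2) Unit R S ⊕ σ₂ → ℝ) ℂ)} (hW : IsArchWeilDatum ι𝕎' ω)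
    (hc : ∀ g, Continuous (ω g))
    {ω₁ : Representation ℂ (Ginf (Fin 2) Unit R S) (SchwartzMap (DPIdx (Fin 2) Unit R S → ℝ) ℂ)}
    (hW₁ : IsArchWeilDatum (ι𝕎 (Fin 2) Unit R S) ω₁) (hc₁ : ∀ u, Continuous (ω₁ u)) {ev : VacExponents}
    (hvac₁ : ∀ kk : DPK (Fin 2) Unit R S, ω₁ (κ (Fin 2) Unit R S kk) (hermitePi 0) = vacScalar ev kk • hermitePi 0)
    (s : Ginf (Fin 2) Unit R S →* G) (hs_cont : Continuous s)
    (hs : ∀ u, (⇑((ι𝕎' (s u)).1 :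
        ((DPIdx (Fin 2) Unit R S ⊕ σ₂ → ℝ) × (DPIdx (Fin 2) Unit R S ⊕ σ₂ → ℝ)) ≃ₗ[ℝ]
          (DPIdx (Fin 2) Unit R S ⊕ σ₂ → ℝ) × (DPIdx (Fin 2) Unit R S ⊕ σ₂ → ℝ)) :
        PhaseMap (DPIdx (Fin 2) Unit R S ⊕ σ₂)) =
      blockPhase (⇑((ι𝕎 (Fin 2) Unit R S u).1 :
        ((DPIdx (Fin 2) Unit R S → ℝ) × (DPIdx (Fin 2) Unit R S → ℝ)) ≃ₗ[ℝ]
          (DPIdx (Fin 2) Unit R S → ℝ) × (DPIdx (Fin 2) Unit R S → ℝ))) id)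
    (τ : SchwartzMap (DPIdx (Fin 2) Unit R S ⊕ σ₂ → ℝ) ℂ →L[ℂ] 𝓢(E', ℂ))
    (hτ : ∀ (b : Fin 2 → ℂ) (x : SchwartzMap (DPIdx (Fin 2) Unit R S ⊕ σ₂ → ℝ) ℂ), ρ b (τ x) =
      τ (ω (s (((u21FrameEquiv (expP b) : UForm (Fin 2) Unit), (1 : UForm R S)) : Ginf (Fin 2) Unit R S)) x))
    (Φ₂ : SchwartzMap (σ₂ → ℝ) ℂ) (Φ₁ : Λ → SchwartzMap (DPIdx (Fin 2) Unit R S → ℝ) ℂ)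
    (hΦ : ∀ ℓ, Φ ℓ = τ (SchwartzMap.sumProdLeftCLM Φ₂ (Φ₁ ℓ))) (T : 𝓢(E', ℂ) →L[ℂ] ℂ) (ℓ : Λ) :
    DifferentiableAt ℝ (fun b => T (ρ b (Φ ℓ))) 0 := by
  obtain ⟨χc, hχc, hω⟩ := hW.exists_circle_twist_factorisation_clm hc hW₁ hc₁ s hs_cont hs τ
    (fun b => ρ b)
    (fun b => (((u21FrameEquiv (expP b) : UForm (Fin 2) Unit), (1 : UForm R S)) : Ginf (Fin 2) Unit R S)) hτ Φ₂
  exact differentiableAt_of_junction ρ Φ hW₁ hvac₁ χc hχc (τ.comp (SchwartzMap.sumProdLeftCLM Φ₂)) Φ₁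
    (fun ℓ => hΦ ℓ) (fun b ℓ => hω b (Φ₁ ℓ)) T ℓ

set_option backward.isDefEq.respectTransparency false in
/-- **(REP) along both `-i e_p` from the big archimedean datum, record-free** (theta-3 `ArchKTypeData.isPMinusKilledAlong_of_blockPair` with
`B.ωinf (e b) ↦ ρ b`, `B.Φarch ↦ Φ`). -/
theorem pMinus_of_blockPair {σ₂ : Type} [Fintype σ₂] [DecidableEq σ₂]
    {G : Type} [Group G] [TopologicalSpace G]
    {ι𝕎' : G →* symplecticGroup (polar (dotPairing (DPIdx (Fin 2) Unit R S ⊕ σ₂)))}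
    {ω : Representation ℂ G (SchwartzMap (DPIdx (Fin 2) Unit R S ⊕ σ₂ → ℝ) ℂ)} (hW : IsArchWeilDatum ι𝕎' ω)
    (hc : ∀ g, Continuous (ω g))
    {ω₁ : Representation ℂ (Ginf (Fin 2) Unit R S) (SchwartzMap (DPIdx (Fin 2) Unit R S → ℝ) ℂ)}
    (hW₁ : IsArchWeilDatum (ι𝕎 (Fin 2) Unit R S) ω₁) (hc₁ : ∀ u, Continuous (ω₁ u))
    (s : Ginf (Fin 2) Unit R S →* G) (hs_cont : Continuous s)
    (hs : ∀ u, (⇑((ι𝕎' (s u)).1 :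
        ((DPIdx (Fin 2) Unit R S ⊕ σ₂ → ℝ) × (DPIdx (Fin 2) Unit R S ⊕ σ₂ → ℝ)) ≃ₗ[ℝ]
          (DPIdx (Fin 2) Unit R S ⊕ σ₂ → ℝ) × (DPIdx (Fin 2) Unit R S ⊕ σ₂ → ℝ)) :
        PhaseMap (DPIdx (Fin 2) Unit R S ⊕ σ₂)) =
      blockPhase (⇑((ι𝕎 (Fin 2) Unit R S u).1 :
        ((DPIdx (Fin 2) Unit R S → ℝ) × (DPIdx (Fin 2) Unit R S → ℝ)) ≃ₗ[ℝ]
          (DPIdx (Fin 2) Unit R S → ℝ) × (DPIdx (Fin 2) Unit R S → ℝ))) id)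
    (τ : SchwartzMap (DPIdx (Fin 2) Unit R S ⊕ σ₂ → ℝ) ℂ →L[ℂ] 𝓢(E', ℂ))
    (hτ : ∀ (b : Fin 2 → ℂ) (x : SchwartzMap (DPIdx (Fin 2) Unit R S ⊕ σ₂ → ℝ) ℂ), ρ b (τ x) =
      τ (ω (s (((u21FrameEquiv (expP b) : UForm (Fin 2) Unit), (1 : UForm R S)) : Ginf (Fin 2) Unit R S)) x))
    (Φ₂ : SchwartzMap (σ₂ → ℝ) ℂ) (Φ₁ : Λ → SchwartzMap (DPIdx (Fin 2) Unit R S → ℝ) ℂ)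
    (hΦ : ∀ ℓ, Φ ℓ = τ (SchwartzMap.sumProdLeftCLM Φ₂ (Φ₁ ℓ)))
    (hf : ∀ (p : Fin 2) ℓ, hypOpGen R S p () (Φ₁ ℓ) + I • rotBoostGen R S p () (Real.pi / 2) (Φ₁ ℓ) = 0)
    (p : Fin 2) (ℓ : Λ) :
    ∃ D Dᵢ : 𝓢(E', ℂ),
      Tendsto (fun t : ℝ => t⁻¹ • (ρ (t • (-Complex.I • (Pi.single p 1 : Fin 2 → ℂ))) (Φ ℓ) - Φ ℓ)) (𝓝[≠] 0) (𝓝 D) ∧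
        Tendsto (fun t : ℝ => t⁻¹ • (ρ (t • (Complex.I • (-Complex.I • (Pi.single p 1 : Fin 2 → ℂ)))) (Φ ℓ) - Φ ℓ))
          (𝓝[≠] 0) (𝓝 Dᵢ) ∧ D + Complex.I • Dᵢ = 0 := by
  obtain ⟨χc, hχc, hω⟩ := hW.exists_circle_twist_factorisation_clm hc hW₁ hc₁ s hs_cont hs τ
    (fun b => ρ b)
    (fun b => (((u21FrameEquiv (expP b) : UForm (Fin 2) Unit), (1 : UForm R S)) : Ginf (Fin 2) Unit R S)) hτ Φ₂
  exact pMinus_of_junction ρ Φ hW₁ χc hχc (τ.comp (SchwartzMap.sumProdLeftCLM Φ₂)) Φ₁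
    (fun ℓ => hΦ ℓ) (fun b ℓ => hω b (Φ₁ ℓ)) p (hf p) ℓ

end Bricks

end ArchPair

/-! ### § 2. The honest slots `k = 0, 1` along `twistU21 ∘ expP` (inputs `h₁W`, `eR eS`, `Φ₂` only) -/

section Slots

variable {L : CMField} {ι₁ : L →+* ℂ} (V : HermSpace3 L ι₁) (c : SeesawCtx L)
variable
  (hGR : (cmSplittingDatum (L : Type) finProdFinEquiv (frameD V) (frameD_real V) (frameD_ne V) (dW c.D) (dW_real c.D)
    (dW_ne c.D)).CompatibleSplitting)
  (hGR₀ : (cmSplittingDatum (L : Type) (e₁) (frameD V) (frameD_real V) (frameD_ne V) (lineVec (L : Type) (dW c.D 0))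
    (fun _ => dW_real c.D 0) (fun _ => dW_ne c.D 0)).CompatibleSplitting)
  (hGR₁ : (cmSplittingDatum (L : Type) (e₁) (frameD V) (frameD_real V) (frameD_ne V) (lineVec (L : Type) (dW c.D 1))
    (fun _ => dW_real c.D 1) (fun _ => dW_ne c.D 1)).CompatibleSplitting)
  (η₀ η₁ : CMAdelic (L : Type) (frameD V) × CMAdelicOne (L : Type) →* ℂˣ)
  (h₁W : (∀ j, 0 < (ι₁ (dW c.D j)).re) ∨ ∀ j, (ι₁ (dW c.D j)).re < 0)
  (Φ₂ : SchwartzMap ((Fin 3 × {v : {v : InfinitePlace ↥(maximalRealSubfield L) // v.IsReal} // v ≠ HypCensus.cmPlace (L : Type) ι₁}) → ℝ) ℂ)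

/-! #### line 0 -/

section Zero

variable
  (eR : PosIdx (cmXW (L : Type) (frameD V) (lineVec (L : Type) (dW c.D 0)) (fun _ => dW_real c.D 0) ι₁ (HypCensus.cmPlace (L : Type) ι₁)) ≃ Unit)
  (eS : NegIdx (cmXW (L : Type) (frameD V) (lineVec (L : Type) (dW c.D 0)) (fun _ => dW_real c.D 0) ι₁ (HypCensus.cmPlace (L : Type) ι₁)) ≃ Empty)

/-- the intertwining `hτ` of the AN/REP bricks for `lineOmega_zero` along `twistU21 ∘ expP`, `τ := F⁻¹` (record-free form of #CA14
`archKTypeOfSlotZero_hτG`). -/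
theorem lineOmega_zero_twistU21_expP_symm_applyG (b : Fin 2 → ℂ)
    (x : SchwartzMap (DPIdx (Fin 2) Unit Unit Empty ⊕
      (Fin 3 × {w : {w : InfinitePlace ↥(maximalRealSubfield L) // w.IsReal} // w ≠ HypCensus.cmPlace (L : Type) ι₁}) → ℝ) ℂ) :
    lineOmega_zero V c.D hGR hGR₀ hGR₁ η₀ (twistU21 L ι₁ (BallForms.expP b))
        (((cmBlockFrameAt (L : Type) e₁ (frameD V) (frameD_real V) (frameD_ne V) (lineVec (L : Type) (dW c.D 0))
          (fun _ => dW_real c.D 0) (fun _ => dW_ne c.D 0) ι₁ (HypCensus.cmPlace (L : Type) ι₁) (blockPosEquiv V) (blockNegEquiv V) eR eS).symm :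
            _ ≃L[ℂ] _) x) =
      ((cmBlockFrameAt (L : Type) e₁ (frameD V) (frameD_real V) (frameD_ne V) (lineVec (L : Type) (dW c.D 0))
          (fun _ => dW_real c.D 0) (fun _ => dW_ne c.D 0) ι₁ (HypCensus.cmPlace (L : Type) ι₁) (blockPosEquiv V) (blockNegEquiv V) eR eS).symm :
            _ ≃L[ℂ] _)
        (cmBlockRepAt (L : Type) e₁ (frameD V) (frameD_real V) (frameD_ne V) (lineVec (L : Type) (dW c.D 0)) (fun _ => dW_real c.D 0)
          (fun _ => dW_ne c.D 0) hGR₀ ι₁ (HypCensus.cmPlace (L : Type) ι₁) (blockPosEquiv V) (blockNegEquiv V) eR eS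
          (cmBlockSectionAt (L : Type) (frameD V) (frameD_real V) (frameD_ne V) (lineVec (L : Type) (dW c.D 0))
            (fun _ => dW_real c.D 0) (fun _ => dW_ne c.D 0) ι₁ (HypCensus.cmPlace (L : Type) ι₁) (blockPosEquiv V) (blockNegEquiv V) eR eS
            (((u21FrameEquiv (BallForms.expP b) : UForm (Fin 2) Unit), (1 : UForm Unit Empty)) : Ginf (Fin 2) Unit Unit Empty)) x) := by
  rw [lineOmega_zero_twistU21_expP_AtG, cmArchWeilRep_cmBlockFrameAt_symm]

set_option backward.isDefEq.respectTransparency false in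
include h₁W in
/-- **(AN) for line 0 along `twistU21 ∘ expP`, record-free** (#CA14 `isWeaklyPDiff_archKTypeOfSlotZeroG` minus the record). -/
theorem differentiableAt_lineOmega_zero_twistU21_expPG
    (T : 𝓢((Fin 3 → mixedSpace (↥(maximalRealSubfield L))), ℂ) →L[ℂ] ℂ) (ℓ : Module.Dual ℂ (Fin 2 → ℂ)) :
    DifferentiableAt ℝ (fun b => T (lineOmega_zero V c.D hGR hGR₀ hGR₁ η₀ (twistU21 L ι₁ (BallForms.expP b))
      (blockFamilyOfAt (L : Type) e₁ (frameD V) (frameD_real V) (frameD_ne V) (lineVec (L : Type) (dW c.D 0)) (fun _ => dW_real c.D 0)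
        (fun _ => dW_ne c.D 0) ι₁ (blockPosEquiv V) (blockNegEquiv V) eR eS (degOnePDual Empty) Φ₂ ℓ))) 0 := by
  obtain ⟨ω₁, hW₁, hc₁⟩ := exists_isArchWeilDatum_lineSlot (R := Unit) (S := Empty)
  obtain ⟨ev₁, hvac₁⟩ := (junction (Fin 2) Unit Unit Empty).exists_vacExponents hW₁
  exact ArchPair.differentiableAt_of_blockPair
    (fun b => lineOmega_zero V c.D hGR hGR₀ hGR₁ η₀ (twistU21 L ι₁ (BallForms.expP b)))
    (blockFamilyOfAt (L : Type) e₁ (frameD V) (frameD_real V) (frameD_ne V) (lineVec (L : Type) (dW c.D 0)) (fun _ => dW_real c.D 0)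
      (fun _ => dW_ne c.D 0) ι₁ (blockPosEquiv V) (blockNegEquiv V) eR eS (degOnePDual Empty) Φ₂)
    (isArchWeilDatum_cmBlockAt (L : Type) e₁ (frameD V) (frameD_real V) (frameD_ne V) (lineVec (L : Type) (dW c.D 0))
      (fun _ => dW_real c.D 0) (fun _ => dW_ne c.D 0) hGR₀ ι₁ (HypCensus.cmPlace (L : Type) ι₁) (blockPosEquiv V) (blockNegEquiv V) eR eS
      (frameD_sign_ι₁' V) (line_hs₁W h₁W 0) (frameD_sign_of_ne V) (fun τ hτ => line_hsW (dW c.D 0) τ hτ))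
    (continuous_cmBlockRepAt (L : Type) e₁ (frameD V) (frameD_real V) (frameD_ne V) (lineVec (L : Type) (dW c.D 0))
      (fun _ => dW_real c.D 0) (fun _ => dW_ne c.D 0) hGR₀ ι₁ (HypCensus.cmPlace (L : Type) ι₁) (blockPosEquiv V) (blockNegEquiv V) eR eS)
    hW₁ hc₁ hvac₁
    (cmBlockSectionAt (L : Type) (frameD V) (frameD_real V) (frameD_ne V) (lineVec (L : Type) (dW c.D 0)) (fun _ => dW_real c.D 0)
      (fun _ => dW_ne c.D 0) ι₁ (HypCensus.cmPlace (L : Type) ι₁) (blockPosEquiv V) (blockNegEquiv V) eR eS)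
    (continuous_cmBlockSectionAt (L : Type) (frameD V) (frameD_real V) (frameD_ne V) (lineVec (L : Type) (dW c.D 0))
      (fun _ => dW_real c.D 0) (fun _ => dW_ne c.D 0) ι₁ (HypCensus.cmPlace (L : Type) ι₁) (blockPosEquiv V) (blockNegEquiv V) eR eS)
    (coe_cmBlockPhaseHomAt_cmBlockSectionAt (L : Type) e₁ (frameD V) (frameD_real V) (frameD_ne V) (lineVec (L : Type) (dW c.D 0))
      (fun _ => dW_real c.D 0) (fun _ => dW_ne c.D 0) ι₁ (HypCensus.cmPlace (L : Type) ι₁) (blockPosEquiv V) (blockNegEquiv V) eR eS)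
    ((cmBlockFrameAt (L : Type) e₁ (frameD V) (frameD_real V) (frameD_ne V) (lineVec (L : Type) (dW c.D 0)) (fun _ => dW_real c.D 0)
      (fun _ => dW_ne c.D 0) ι₁ (HypCensus.cmPlace (L : Type) ι₁) (blockPosEquiv V) (blockNegEquiv V) eR eS).symm.toContinuousLinearMap)
    (lineOmega_zero_twistU21_expP_symm_applyG V c hGR hGR₀ hGR₁ η₀ eR eS)
    Φ₂ (degOnePDual Empty) (fun _ => rfl) T ℓ

set_option backward.isDefEq.respectTransparency false in
include h₁W in
/-- **(REP) for line 0 along `twistU21 ∘ expP` and `-i e_p`, record-free** (#CA14 `isPMinusKilledAlong_archKTypeOfSlotZero_twistG` minus the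
record). -/
theorem pMinus_lineOmega_zero_twistU21_expPG (p : Fin 2) (ℓ : Module.Dual ℂ (Fin 2 → ℂ)) :
    ∃ D Dᵢ : 𝓢((Fin 3 → mixedSpace (↥(maximalRealSubfield L))), ℂ),
      Tendsto (fun t : ℝ => t⁻¹ • (lineOmega_zero V c.D hGR hGR₀ hGR₁ η₀
          (twistU21 L ι₁ (BallForms.expP (t • (-Complex.I • (Pi.single p 1 : Fin 2 → ℂ)))))
          (blockFamilyOfAt (L : Type) e₁ (frameD V) (frameD_real V) (frameD_ne V) (lineVec (L : Type) (dW c.D 0)) (fun _ => dW_real c.D 0)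
            (fun _ => dW_ne c.D 0) ι₁ (blockPosEquiv V) (blockNegEquiv V) eR eS (degOnePDual Empty) Φ₂ ℓ) -
          blockFamilyOfAt (L : Type) e₁ (frameD V) (frameD_real V) (frameD_ne V) (lineVec (L : Type) (dW c.D 0)) (fun _ => dW_real c.D 0)
            (fun _ => dW_ne c.D 0) ι₁ (blockPosEquiv V) (blockNegEquiv V) eR eS (degOnePDual Empty) Φ₂ ℓ)) (𝓝[≠] 0) (𝓝 D) ∧
      Tendsto (fun t : ℝ => t⁻¹ • (lineOmega_zero V c.D hGR hGR₀ hGR₁ η₀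
          (twistU21 L ι₁ (BallForms.expP (t • (Complex.I • (-Complex.I • (Pi.single p 1 : Fin 2 → ℂ))))))
          (blockFamilyOfAt (L : Type) e₁ (frameD V) (frameD_real V) (frameD_ne V) (lineVec (L : Type) (dW c.D 0)) (fun _ => dW_real c.D 0)
            (fun _ => dW_ne c.D 0) ι₁ (blockPosEquiv V) (blockNegEquiv V) eR eS (degOnePDual Empty) Φ₂ ℓ) -
          blockFamilyOfAt (L : Type) e₁ (frameD V) (frameD_real V) (frameD_ne V) (lineVec (L : Type) (dW c.D 0)) (fun _ => dW_real c.D 0)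
            (fun _ => dW_ne c.D 0) ι₁ (blockPosEquiv V) (blockNegEquiv V) eR eS (degOnePDual Empty) Φ₂ ℓ)) (𝓝[≠] 0) (𝓝 Dᵢ) ∧
      D + Complex.I • Dᵢ = 0 := by
  obtain ⟨ω₁, hW₁, hc₁⟩ := exists_isArchWeilDatum_lineSlot (R := Unit) (S := Empty)
  exact ArchPair.pMinus_of_blockPair
    (fun b => lineOmega_zero V c.D hGR hGR₀ hGR₁ η₀ (twistU21 L ι₁ (BallForms.expP b)))
    (blockFamilyOfAt (L : Type) e₁ (frameD V) (frameD_real V) (frameD_ne V) (lineVec (L : Type) (dW c.D 0)) (fun _ => dW_real c.D 0)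
      (fun _ => dW_ne c.D 0) ι₁ (blockPosEquiv V) (blockNegEquiv V) eR eS (degOnePDual Empty) Φ₂)
    (isArchWeilDatum_cmBlockAt (L : Type) e₁ (frameD V) (frameD_real V) (frameD_ne V) (lineVec (L : Type) (dW c.D 0))
      (fun _ => dW_real c.D 0) (fun _ => dW_ne c.D 0) hGR₀ ι₁ (HypCensus.cmPlace (L : Type) ι₁) (blockPosEquiv V) (blockNegEquiv V) eR eS
      (frameD_sign_ι₁' V) (line_hs₁W h₁W 0) (frameD_sign_of_ne V) (fun τ hτ => line_hsW (dW c.D 0) τ hτ))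
    (continuous_cmBlockRepAt (L : Type) e₁ (frameD V) (frameD_real V) (frameD_ne V) (lineVec (L : Type) (dW c.D 0))
      (fun _ => dW_real c.D 0) (fun _ => dW_ne c.D 0) hGR₀ ι₁ (HypCensus.cmPlace (L : Type) ι₁) (blockPosEquiv V) (blockNegEquiv V) eR eS)
    hW₁ hc₁
    (cmBlockSectionAt (L : Type) (frameD V) (frameD_real V) (frameD_ne V) (lineVec (L : Type) (dW c.D 0)) (fun _ => dW_real c.D 0)
      (fun _ => dW_ne c.D 0) ι₁ (HypCensus.cmPlace (L : Type) ι₁) (blockPosEquiv V) (blockNegEquiv V) eR eS)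
    (continuous_cmBlockSectionAt (L : Type) (frameD V) (frameD_real V) (frameD_ne V) (lineVec (L : Type) (dW c.D 0))
      (fun _ => dW_real c.D 0) (fun _ => dW_ne c.D 0) ι₁ (HypCensus.cmPlace (L : Type) ι₁) (blockPosEquiv V) (blockNegEquiv V) eR eS)
    (coe_cmBlockPhaseHomAt_cmBlockSectionAt (L : Type) e₁ (frameD V) (frameD_real V) (frameD_ne V) (lineVec (L : Type) (dW c.D 0))
      (fun _ => dW_real c.D 0) (fun _ => dW_ne c.D 0) ι₁ (HypCensus.cmPlace (L : Type) ι₁) (blockPosEquiv V) (blockNegEquiv V) eR eS)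
    ((cmBlockFrameAt (L : Type) e₁ (frameD V) (frameD_real V) (frameD_ne V) (lineVec (L : Type) (dW c.D 0)) (fun _ => dW_real c.D 0)
      (fun _ => dW_ne c.D 0) ι₁ (HypCensus.cmPlace (L : Type) ι₁) (blockPosEquiv V) (blockNegEquiv V) eR eS).symm.toContinuousLinearMap)
    (lineOmega_zero_twistU21_expP_symm_applyG V c hGR hGR₀ hGR₁ η₀ eR eS)
    Φ₂ (degOnePDual Empty) (fun _ => rfl) (hypOpGen_add_I_smul_rotBoostGen_degOnePDual Empty) p ℓ

/-! ##### § 3 (line 0): at `expP` with the canonical representative — (a4) `hd`, the `𝔭₋`-limits, (a5) `hCR` -/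

include h₁W in
/-- **(a4) for line 0 — `hd` of sinst-1's #1251, record-free**: `b ↦ T (lineOmega_zero … (expP b) (Φ_∞,0(ℓ)))` is real-differentiable at `0`
(canonical representative `hemb`: `twistU21 = id`). -/
theorem hd_lineOmega_zeroG (hemb : (InfinitePlace.mk ι₁).embedding = ι₁)
    (T : 𝓢((Fin 3 → mixedSpace (↥(maximalRealSubfield L))), ℂ) →L[ℂ] ℂ) (ℓ : Module.Dual ℂ (Fin 2 → ℂ)) :
    DifferentiableAt ℝ (fun b => T (lineOmega_zero V c.D hGR hGR₀ hGR₁ η₀ (BallForms.expP b)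
      (blockFamilyOfAt (L : Type) e₁ (frameD V) (frameD_real V) (frameD_ne V) (lineVec (L : Type) (dW c.D 0)) (fun _ => dW_real c.D 0)
        (fun _ => dW_ne c.D 0) ι₁ (blockPosEquiv V) (blockNegEquiv V) eR eS (degOnePDual Empty) Φ₂ ℓ))) 0 := by
  have h := differentiableAt_lineOmega_zero_twistU21_expPG V c hGR hGR₀ hGR₁ η₀ h₁W Φ₂ eR eS T ℓ
  simp only [twistU21_eq_self_of_embedding_eq hemb] at h
  exact h

include h₁W in
/-- the `𝔭₋`-limits of line 0 at `expP` along `-i e_p` (row 15 `hk` in the END-STATE shape, record-free). -/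
theorem pMinus_lineOmega_zeroG (hemb : (InfinitePlace.mk ι₁).embedding = ι₁) (p : Fin 2) (ℓ : Module.Dual ℂ (Fin 2 → ℂ)) :
    ∃ D Dᵢ : 𝓢((Fin 3 → mixedSpace (↥(maximalRealSubfield L))), ℂ),
      Tendsto (fun t : ℝ => t⁻¹ • (lineOmega_zero V c.D hGR hGR₀ hGR₁ η₀
          (BallForms.expP (t • (-Complex.I • (Pi.single p 1 : Fin 2 → ℂ))))
          (blockFamilyOfAt (L : Type) e₁ (frameD V) (frameD_real V) (frameD_ne V) (lineVec (L : Type) (dW c.D 0)) (fun _ => dW_real c.D 0)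
            (fun _ => dW_ne c.D 0) ι₁ (blockPosEquiv V) (blockNegEquiv V) eR eS (degOnePDual Empty) Φ₂ ℓ) -
          blockFamilyOfAt (L : Type) e₁ (frameD V) (frameD_real V) (frameD_ne V) (lineVec (L : Type) (dW c.D 0)) (fun _ => dW_real c.D 0)
            (fun _ => dW_ne c.D 0) ι₁ (blockPosEquiv V) (blockNegEquiv V) eR eS (degOnePDual Empty) Φ₂ ℓ)) (𝓝[≠] 0) (𝓝 D) ∧
      Tendsto (fun t : ℝ => t⁻¹ • (lineOmega_zero V c.D hGR hGR₀ hGR₁ η₀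
          (BallForms.expP (t • (Complex.I • (-Complex.I • (Pi.single p 1 : Fin 2 → ℂ)))))
          (blockFamilyOfAt (L : Type) e₁ (frameD V) (frameD_real V) (frameD_ne V) (lineVec (L : Type) (dW c.D 0)) (fun _ => dW_real c.D 0)
            (fun _ => dW_ne c.D 0) ι₁ (blockPosEquiv V) (blockNegEquiv V) eR eS (degOnePDual Empty) Φ₂ ℓ) -
          blockFamilyOfAt (L : Type) e₁ (frameD V) (frameD_real V) (frameD_ne V) (lineVec (L : Type) (dW c.D 0)) (fun _ => dW_real c.D 0)
            (fun _ => dW_ne c.D 0) ι₁ (blockPosEquiv V) (blockNegEquiv V) eR eS (degOnePDual Empty) Φ₂ ℓ)) (𝓝[≠] 0) (𝓝 Dᵢ) ∧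
      D + Complex.I • Dᵢ = 0 := by
  have h := pMinus_lineOmega_zero_twistU21_expPG V c hGR hGR₀ hGR₁ η₀ h₁W Φ₂ eR eS p ℓ
  simp only [twistU21_eq_self_of_embedding_eq hemb] at h
  exact h

include h₁W in
/-- **(a5) for line 0 — `hCR` of sinst-1's #1251, record-free**: the scalarised differential at `0` of
`b ↦ T (lineOmega_zero … (expP b) (Φ_∞,0(ℓ)))` is complex-linear (record-free twin of `ThetaHolDirections.isWeaklyCR_of_isPMinusKilledAlong`,
`c p := -i`). -/
theorem hCR_lineOmega_zeroG (hemb : (InfinitePlace.mk ι₁).embedding = ι₁)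
    (T : 𝓢((Fin 3 → mixedSpace (↥(maximalRealSubfield L))), ℂ) →L[ℂ] ℂ) (ℓ : Module.Dual ℂ (Fin 2 → ℂ)) (v : Fin 2 → ℂ) :
    fderiv ℝ (fun b => T (lineOmega_zero V c.D hGR hGR₀ hGR₁ η₀ (BallForms.expP b)
        (blockFamilyOfAt (L : Type) e₁ (frameD V) (frameD_real V) (frameD_ne V) (lineVec (L : Type) (dW c.D 0)) (fun _ => dW_real c.D 0)
          (fun _ => dW_ne c.D 0) ι₁ (blockPosEquiv V) (blockNegEquiv V) eR eS (degOnePDual Empty) Φ₂ ℓ))) 0 (Complex.I • v) =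
      Complex.I • fderiv ℝ (fun b => T (lineOmega_zero V c.D hGR hGR₀ hGR₁ η₀ (BallForms.expP b)
        (blockFamilyOfAt (L : Type) e₁ (frameD V) (frameD_real V) (frameD_ne V) (lineVec (L : Type) (dW c.D 0)) (fun _ => dW_real c.D 0)
          (fun _ => dW_ne c.D 0) ι₁ (blockPosEquiv V) (blockNegEquiv V) eR eS (degOnePDual Empty) Φ₂ ℓ))) 0 v := by
  have h0 : lineOmega_zero V c.D hGR hGR₀ hGR₁ η₀ (BallForms.expP 0)
      (blockFamilyOfAt (L : Type) e₁ (frameD V) (frameD_real V) (frameD_ne V) (lineVec (L : Type) (dW c.D 0)) (fun _ => dW_real c.D 0)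
        (fun _ => dW_ne c.D 0) ι₁ (blockPosEquiv V) (blockNegEquiv V) eR eS (degOnePDual Empty) Φ₂ ℓ) =
      blockFamilyOfAt (L : Type) e₁ (frameD V) (frameD_real V) (frameD_ne V) (lineVec (L : Type) (dW c.D 0)) (fun _ => dW_real c.D 0)
        (fun _ => dW_ne c.D 0) ι₁ (blockPosEquiv V) (blockNegEquiv V) eR eS (degOnePDual Empty) Φ₂ ℓ := by
    rw [BallForms.expP_zero, map_one, Module.End.one_apply]
  refine ThetaHolDirections.apply_I_smul_of_basis
    ((fderiv ℝ (fun b => T (lineOmega_zero V c.D hGR hGR₀ hGR₁ η₀ (BallForms.expP b)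
      (blockFamilyOfAt (L : Type) e₁ (frameD V) (frameD_real V) (frameD_ne V) (lineVec (L : Type) (dW c.D 0)) (fun _ => dW_real c.D 0)
        (fun _ => dW_ne c.D 0) ι₁ (blockPosEquiv V) (blockNegEquiv V) eR eS (degOnePDual Empty) Φ₂ ℓ))) 0).toLinearMap)
    (fun _ => -Complex.I) (fun _ => neg_ne_zero.2 Complex.I_ne_zero) (fun p => ?_) v
  obtain ⟨D, Dᵢ, hD, hDᵢ, hsum⟩ := pMinus_lineOmega_zeroG V c hGR hGR₀ hGR₁ η₀ h₁W Φ₂ eR eS hemb p ℓ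
  exact ThetaHolAssembly.fderiv_I_smul_of_slopes T
    (Ψ := fun b => lineOmega_zero V c.D hGR hGR₀ hGR₁ η₀ (BallForms.expP b)
      (blockFamilyOfAt (L : Type) e₁ (frameD V) (frameD_real V) (frameD_ne V) (lineVec (L : Type) (dW c.D 0)) (fun _ => dW_real c.D 0)
        (fun _ => dW_ne c.D 0) ι₁ (blockPosEquiv V) (blockNegEquiv V) eR eS (degOnePDual Empty) Φ₂ ℓ))
    (hd_lineOmega_zeroG V c hGR hGR₀ hGR₁ η₀ h₁W Φ₂ eR eS hemb T ℓ) _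
    (by simpa only [h0] using hD) (by simpa only [h0] using hDᵢ) hsum

end Zero

/-! #### line 1 -/

section One

variable
  (eR : PosIdx (cmXW (L : Type) (frameD V) (lineVec (L : Type) (dW c.D 1)) (fun _ => dW_real c.D 1) ι₁ (HypCensus.cmPlace (L : Type) ι₁)) ≃ Unit)
  (eS : NegIdx (cmXW (L : Type) (frameD V) (lineVec (L : Type) (dW c.D 1)) (fun _ => dW_real c.D 1) ι₁ (HypCensus.cmPlace (L : Type) ι₁)) ≃ Empty)


-- port_pkg: scope closed for this part
end One
end Slots
end HodgeCM.Model
end
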